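import Literature.NumberTheory.LFunctions.RudnickSarnakFibre
import Literature.NumberTheory.LFunctions.RudnickSarnakRefine
import HarnessLib

/-!
# Gluing strata: `H_G` fibred over the coarser block sums

Rudnick–Sarnak, Duke Math. J. **81** (1996), Lemma 4.1 / (4.13): for set partitions `Q ≤ G`
of `N` (every block of `G` a union of blocks of `Q`), a point `u` of the stratum
`H_G = {∑_{i ∈ C} u_i = 0, C ∈ G}` is determined by its `Q`-block sums (which vanish on each
`G`-block, i.e. are free on the `Q`-blocks not containing the least element of their `G`-block)
together with its position in the fibre of the `Q`-block-sum map; correspondingly the integral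
over `H_G` (in the coordinates `extG G` of `RudnickSarnakStrata.lean`) is an iterated integral,
first over the fibres (coordinates `Free Q`), then over the new block sums (coordinates
`NewFree Q G`, the representatives of `Q` which are not representatives of `G`). This is the
measure-theoretic content of "`∫ Φ(u) C_F(u) du = ∫ Φ_F(v) C_O(v) dv`" (p. 306) on each
stratum; the change of variables is a shear followed by a regrouping of coordinates, so no
Jacobian appears.

* `NewFree Q G`, `glue Q G t w` (the free `G`-coordinates of the glued point), `glueMEquiv`,
  `measurePreserving_glueMEquiv`, `integral_extG_eq_integral_integral_glue`.

## References

* Z. Rudnick, P. Sarnak, Duke Math. J. 81 (1996), (4.13), Lemma 4.1.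
-/

noncomputable section

open MeasureTheory Finset

namespace Literature.NumberTheory.LFunctions

namespace RudnickSarnak

variable {n : ℕ} (Q G : Finpartition (univ : Finset (Fin n)))

/-! ## New free indices and the glued coordinates

(If `Q` refines `G`, every representative of `G` is one of `Q`:
`RudnickSarnakRefine.isRep_of_isRep_of_subset`.) -/

/-- The new free indices when passing from `Q` to the coarser `G`: representatives of `Q`
which are not representatives of `G`. [cite: RudnickSarnak1996, (4.13)] -/
abbrev NewFree : Type := {j : Fin n // IsRep Q j ∧ ¬IsRep G j}

/-- The free sum of a `Q`-block: `∑_{i ∈ Q.part j, i ≠ j} w_i`. [folklore] -/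
def freeSum (w : Free Q → ℝ) (j : Fin n) : ℝ := ∑ i ∈ (Q.part j).erase j, liftFree Q w i

/-- The glued free `G`-coordinates: a free `Q`-index keeps its coordinate `w_j`; a new free
index `j` (a `Q`-representative which is not a `G`-representative) gets `t_j - freeSum w j`,
so that its `Q`-block sums to `t_j`. [cite: RudnickSarnak1996, (4.13)] -/
def glue (t : NewFree Q G → ℝ) (w : Free Q → ℝ) (j : Free G) : ℝ :=
  if h : IsRep Q j.1 then t ⟨j.1, h, j.2⟩ - freeSum Q w j.1 else w ⟨j.1, h⟩

/-- Measurability of `w ↦ (-freeSum w j)_{j new free}` (the translation part of the shear).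
[folklore] -/
theorem measurable_neg_freeSum_newFree :
    Measurable fun w : Free Q → ℝ ↦ fun j : NewFree Q G ↦ -freeSum Q w j.1 := by
  refine measurable_pi_iff.2 fun j ↦ ?_
  refine (Finset.measurable_sum _ fun i _ ↦ ?_).neg
  by_cases h : IsRep Q i
  · simp only [liftFree, h, ↓reduceDIte]
    exact measurable_const
  · simp only [liftFree, h, ↓reduceDIte]
    exact measurable_pi_apply _

section equivs

variable (hQG : ∀ a : Fin n, Q.part a ⊆ G.part a)
include hQG

/-- `NewFree Q G ≃ {j : Free G // IsRep Q j}`. [folklore] -/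
def newFreeEquiv : NewFree Q G ≃ {j : Free G // IsRep Q j.1} where
  toFun j := ⟨⟨j.1, j.2.2⟩, j.2.1⟩
  invFun j := ⟨j.1.1, j.2, j.1.2⟩
  left_inv _ := rfl
  right_inv _ := rfl

/-- `Free Q ≃ {j : Free G // ¬IsRep Q j}` (a free `Q`-index is a free `G`-index). [folklore] -/
def freeEquiv : Free Q ≃ {j : Free G // ¬IsRep Q j.1} where
  toFun j := ⟨⟨j.1, fun h ↦ j.2 (isRep_of_isRep_of_subset G hQG h)⟩, j.2⟩
  invFun j := ⟨j.1.1, j.2⟩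
  left_inv _ := rfl
  right_inv _ := rfl

/-- **The gluing change of variables** `(t, w) ↦ glue t w` as a measurable equivalence: a shear,
a reindexing, and the regrouping of the coordinates of `Free G` according to `IsRep Q`.
[cite: RudnickSarnak1996, (4.13)] -/
def glueMEquiv : (NewFree Q G → ℝ) × (Free Q → ℝ) ≃ᵐ (Free G → ℝ) :=
  (shearMEquiv (fun w : Free Q → ℝ ↦ fun j : NewFree Q G ↦ -freeSum Q w j.1)
    (measurable_neg_freeSum_newFree Q G)).trans
    ((MeasurableEquiv.prodCongr
      (MeasurableEquiv.piCongrLeft (fun _ : {j : Free G // IsRep Q j.1} ↦ ℝ) (newFreeEquiv Q G))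
      (MeasurableEquiv.piCongrLeft (fun _ : {j : Free G // ¬IsRep Q j.1} ↦ ℝ) (freeEquiv Q G hQG))).trans
    (MeasurableEquiv.piEquivPiSubtypeProd (fun _ : Free G ↦ ℝ) (fun j ↦ IsRep Q j.1)).symm)

/-- **The gluing map preserves Lebesgue measure.** [cite: RudnickSarnak1996, (4.13)] -/
theorem measurePreserving_glueMEquiv :
    MeasurePreserving (glueMEquiv Q G hQG)
      ((volume : Measure (NewFree Q G → ℝ)).prod (volume : Measure (Free Q → ℝ))) volume := by
  unfold glueMEquiv
  rw [MeasurableEquiv.coe_trans, MeasurableEquiv.coe_trans]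
  refine ((volume_preserving_piEquivPiSubtypeProd (fun _ : Free G ↦ ℝ) (fun j ↦ IsRep Q j.1)).symm
    _).comp ?_
  refine MeasurePreserving.comp ?_ (measurePreserving_shear _ _ _ _)
  exact (volume_measurePreserving_piCongrLeft (fun _ : {j : Free G // IsRep Q j.1} ↦ ℝ) _).prod
    (volume_measurePreserving_piCongrLeft (fun _ : {j : Free G // ¬IsRep Q j.1} ↦ ℝ) _)

/-- The gluing equivalence is the map `glue`. [folklore] -/
theorem glueMEquiv_apply (t : NewFree Q G → ℝ) (w : Free Q → ℝ) :
    glueMEquiv Q G hQG (t, w) = glue Q G t w := by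
  funext j
  simp only [glueMEquiv, MeasurableEquiv.trans_apply, MeasurableEquiv.prodCongr,
    MeasurableEquiv.coe_mk, Equiv.prodCongr_apply, shearMEquiv, Equiv.coe_fn_mk,
    MeasurableEquiv.piEquivPiSubtypeProd_symm_apply, glue, Prod.map_apply]
  by_cases h : IsRep Q j.1
  · rw [dif_pos h, dif_pos h]
    have := MeasurableEquiv.piCongrLeft_apply_apply (newFreeEquiv Q G)
      (β := fun _ : {j : Free G // IsRep Q j.1} ↦ ℝ)
      (t + fun i : NewFree Q G ↦ -freeSum Q w i.1) ⟨j.1, h, j.2⟩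
    exact this.trans (by rw [Pi.add_apply, ← sub_eq_add_neg])
  · rw [dif_neg h, dif_neg h]
    exact MeasurableEquiv.piCongrLeft_apply_apply (freeEquiv Q G hQG)
      (β := fun _ : {j : Free G // ¬IsRep Q j.1} ↦ ℝ) w ⟨j.1, h⟩

/-- **Integrals over the free `G`-coordinates as iterated integrals over new block sums and
fibres**: `∫ H(u') du' = ∫ (∫ H(glue t w) dw) dt` for integrable `H`. [cite: RudnickSarnak1996, Lemma 4.1] -/
theorem integral_eq_integral_integral_glue {E : Type*} [NormedAddCommGroup E] [NormedSpace ℝ E]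
    {H : (Free G → ℝ) → E} (hH : Integrable H) :
    (∫ u' : Free G → ℝ, H u') = ∫ t : NewFree Q G → ℝ, ∫ w : Free Q → ℝ, H (glue Q G t w) := by
  set e := glueMEquiv Q G hQG with he
  have hev := measurePreserving_glueMEquiv Q G hQG
  have hHint : Integrable (H ∘ e) ((volume : Measure (NewFree Q G → ℝ)).prod volume) :=
    (hev.integrable_comp_emb e.measurableEmbedding).2 hH
  rw [← hev.integral_comp' (f := e) H, integral_prod (fun p ↦ H (e p)) hHint]
  refine integral_congr_ae (Filter.Eventually.of_forall fun t ↦ ?_)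
  refine integral_congr_ae (Filter.Eventually.of_forall fun w ↦ ?_)
  simp only [he]
  rw [glueMEquiv_apply]

/-- **The integral over `H_G` as an iterated integral over new block sums and fibres**:
`∫ F(extG G u') du' = ∫ (∫ F(extG G (glue t w)) dw) dt` for integrable `F ∘ extG G`.
[cite: RudnickSarnak1996, Lemma 4.1] -/
theorem integral_extG_eq_integral_integral_glue {E : Type*} [NormedAddCommGroup E] [NormedSpace ℝ E]
    {F : (Fin n → ℝ) → E} (hF : Integrable fun u' : Free G → ℝ ↦ F (extG G u')) :
    (∫ u' : Free G → ℝ, F (extG G u')) =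
      ∫ t : NewFree Q G → ℝ, ∫ w : Free Q → ℝ, F (extG G (glue Q G t w)) :=
  integral_eq_integral_integral_glue Q G hQG hF

/-! ## Block sums of the glued point -/

/-- The free `G`-coordinates of the glued point: `extG G (glue t w)` agrees with `w` on free
`Q`-indices. [folklore] -/
theorem extG_glue_apply_of_not_isRep (t : NewFree Q G → ℝ) (w : Free Q → ℝ) {j : Fin n}
    (h : ¬IsRep Q j) :
    extG G (glue Q G t w) j = w ⟨j, h⟩ := by
  have hG : ¬IsRep G j := fun h' ↦ h (isRep_of_isRep_of_subset G hQG h')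
  rw [extG_apply_of_not_isRep G _ hG, glue, dif_neg h]

omit hQG in
/-- At a new free index the glued point is `t_j - freeSum w j`. [folklore] -/
theorem extG_glue_apply_of_newFree (t : NewFree Q G → ℝ) (w : Free Q → ℝ) (j : NewFree Q G) :
    extG G (glue Q G t w) j = t j - freeSum Q w j := by
  rw [extG_apply_of_not_isRep G _ j.2.2, glue, dif_pos j.2.1]

/-- **The `Q`-block sum of the glued point at a new free index is `t_j`.**
[cite: RudnickSarnak1996, (4.13)] -/
theorem sum_part_extG_glue_of_newFree (t : NewFree Q G → ℝ) (w : Free Q → ℝ) (j : NewFree Q G) :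
    ∑ i ∈ Q.part j.1, extG G (glue Q G t w) i = t j := by
  have hj : j.1 ∈ Q.part j.1 := Q.mem_part_self.2 (mem_univ _)
  rw [← Finset.add_sum_erase _ _ hj, extG_glue_apply_of_newFree, freeSum]
  have : ∀ i ∈ (Q.part j.1).erase j.1, extG G (glue Q G t w) i = liftFree Q w i := by
    intro i hi
    obtain ⟨hne, hi⟩ := Finset.mem_erase.1 hi
    have hnot : ¬IsRep Q i := fun h ↦ hne (by rw [eq_rep_of_isRep_of_mem Q h hi, j.2.1])
    rw [extG_glue_apply_of_not_isRep Q G hQG t w hnot, liftFree_apply_of_not_isRep Q w hnot]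
  rw [Finset.sum_congr rfl this]
  ring

end equivs

end RudnickSarnak

end Literature.NumberTheory.LFunctions

end
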